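import Literature.AlgebraicGeometry.Motives.FiberNetExistence
import Literature.AlgebraicGeometry.Motives.ComplexPointsEhresmann
import Literature.AlgebraicGeometry.HodgeTheory.HyperplaneSectionMonodromySmoothLocus
import Literature.AlgebraicGeometry.HodgeTheory.HodgeFiltrationModelsReductionProofs
import Literature.NumberTheory.Transcendental.AnalytificationConnectedOpen
import HarnessLib

/-!
# The smooth fibres of a net over `ℂ`: one topological type, one set of Hodge numbers

Topic `Literature/AlgebraicGeometry/Motives`; theorems-only companion of `Motives/SurfaceNet`
(`FiberNet r m X`: nets of `r`-folds `π : X̃ → ℙᵐ` with smooth base `U = ℙᵐ ∖ Δ`),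
`Motives/SurfaceNetGeometricGenus` (`FiberNet.HasFibreHodgeNumber N k p q h`) and
`Motives/FiberNetExistence(Proofs)` (the named fact `fiberNet_exists_hasFibreHodgeNumber`, constancy
of the Hodge numbers of the smooth fibres, and its reduction to Voisin I Cor. 9.19 through the LOCAL
constancy of Betti and Hodge numbers of the fibres of the smooth family `π⁻¹(U) → U`). Recorded here
are the two GLOBAL statements over the connected `U(ℂ)` that the route files and the predicate
`HasFibreHodgeNumber` tacitly use, all proved (no definition, no named fact):

* `nonempty_homeomorph_fibre_of_isPreconnected` — point-set: if `f : E → B` is a product over a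
  neighbourhood of every point of a preconnected `S ⊆ B`, any two fibres over `S` are homeomorphic
  (the relation "homeomorphic fibres" has open classes; `IsPreconnected.induction₂`);
* `FiberNet.exists_trivialisation_smoothBase` — Ehresmann over the smooth base, on the carriers
  `X̃(ℂ) → ℙᵐ(ℂ)` (the tree's `exists_trivialisation_of_smoothOfRelativeDimension_morphismRestrict`);
  `FiberNet.isConnected_setOf_pt_mem_smoothBase` — `{b ∈ ℙᵐ(ℂ) | b ∈ U}` is connected when `U ≠ ∅`
  (SGA1 XII Prop. 2.4, the tree's `ComplexPoints.isConnected_setOf_pt_mem_inter_of_isIrreducible`);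
* `FiberNet.nonempty_homeomorph_complexPoints_fiber` — **all smooth fibres of a net over `ℂ` are
  homeomorphic**: `X_b(ℂ) ≃ₜ X_{b'}(ℂ)` for `b, b' ∈ U(ℂ)` (Voisin I §9.1.1: the fibres of a family of
  compact complex manifolds over a connected base are all diffeomorphic — Thm. 9.3, Ehresmann; the
  tree's Ehresmann records homeomorphisms), whence `FiberNet.finrank_complexBetti_fiber_eq`: the
  Betti numbers `b_k(X_b)` of the smooth fibres are all equal;
* `HodgeModel.finrank_hodgePQ_eq_of_hodgeModel` — **`dim_ℂ H^{p,q}` does not depend on the Hodge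
  model** of a smooth projective variety (from the tree's `hodgePQ_independent_of_hodgeModel_holds`),
  whence `FiberNet.HasFibreHodgeNumber.finrank_eq` (the `h` of the predicate is `dim H^{p,q}` of
  EVERY Hodge model of every smooth fibre, not only of some) and
  `FiberNet.HasFibreHodgeNumber.unique` (the `h` is unique as soon as `U ≠ ∅` — always the case over
  `ℂ`, `FiberNet.smoothBase_nonempty_of_charZero`), the uniqueness left open in the module docstring
  of `SurfaceNetGeometricGenus`.

## References

* [VoisinHodgeI2002] C. Voisin, Hodge Theory and Complex Algebraic Geometry I, CUP 2002, §9.1.1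
  Def. 9.2 and Thm. 9.3 (PDF p. 182); Prop. 6.11 and §7.3.2.
* [SGA1] A. Grothendieck, M. Raynaud, SGA 1, Exp. XII Prop. 2.4.
* [BrockerJanichIDT1982] Th. Bröcker, K. Jänich, Introduction to Differential Topology, (8.12).
-/

noncomputable section

open CategoryTheory AlgebraicGeometry Filter
open scoped Topology
open Literature.AlgebraicGeometry.HodgeTheory Literature.AlgebraicTopology.SingularHomology

namespace Literature.AlgebraicGeometry.Motives

/-! ### Point-set topology: fibres over a preconnected set covered by trivialising opens -/

section Topology

universe u v w

variable {E : Type u} {B : Type v} [TopologicalSpace E] [TopologicalSpace B]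

/-- **Over a preconnected set covered by trivialising opens, all fibres are homeomorphic**: if
every point `t ∈ S` has an open neighbourhood `V` over which `f` is a product `V × F`
(`fibreHomeomorphOfTrivialisation`: then every fibre over `V` is `≃ₜ F`), then `f⁻¹(s) ≃ₜ f⁻¹(s')`
for all `s, s' ∈ S` — the relation "homeomorphic fibres" is an equivalence relation whose classes
are open in the preconnected `S` (Voisin I §9.1.1 for a connected base).
[cite: VoisinHodgeI2002, §9.1.1 Def. 9.2 and Thm. 9.3] [cite: BrockerJanichIDT1982, (8.12)] -/
theorem nonempty_homeomorph_fibre_of_isPreconnected (f : E → B) {S : Set B} (hS : IsPreconnected S)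
    (htriv : ∀ t ∈ S, ∃ V : Set B, IsOpen V ∧ t ∈ V ∧
      ∃ (F : Type w) (_ : TopologicalSpace F) (φ : ↥V × F ≃ₜ ↥(f ⁻¹' V)),
        ∀ x, f (φ x : E) = (x.1 : B))
    {s s' : B} (hs : s ∈ S) (hs' : s' ∈ S) : Nonempty (↥(f ⁻¹' {s}) ≃ₜ ↥(f ⁻¹' {s'})) := by
  refine hS.induction₂ (fun a b => Nonempty (↥(f ⁻¹' {a}) ≃ₜ ↥(f ⁻¹' {b}))) (fun t ht => ?_)
    (fun _ _ _ _ _ _ h₁ h₂ => ?_) (fun _ _ _ _ h => ?_) hs hs'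
  · obtain ⟨V, hVo, htV, F, _, φ, hφ⟩ := htriv t ht
    filter_upwards [mem_nhdsWithin_of_mem_nhds (hVo.mem_nhds htV)] with a haV
    exact ⟨(fibreHomeomorphOfTrivialisation φ hφ htV).trans
      (fibreHomeomorphOfTrivialisation φ hφ haV).symm⟩
  · obtain ⟨e₁⟩ := h₁
    obtain ⟨e₂⟩ := h₂
    exact ⟨e₁.trans e₂⟩
  · obtain ⟨e⟩ := h
    exact ⟨e.symm⟩

end Topology

/-! ### Hodge models: `dim H^{p,q}` does not depend on the model -/

section Models

variable {n : ℕ} {Y : SchemeOver ℂ}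

/-- **`dim_ℂ H^{p,q}` does not depend on the Hodge model.** For `Y` smooth projective and two Hodge
models `A`, `A'`, the pieces `H^{p,q}(A) ⊆ Hᵏ(A.carrier)` and `H^{p,q}(A') ⊆ Hᵏ(A'.carrier)` are the
images, under the bijective pull-backs from `Hᵏ(Y(ℂ); ℂ)` (`HodgeModel.pullback_injective/surjective`),
of ONE subspace of `Hᵏ(Y(ℂ); ℂ)` — the tree's theorem `hodgePQ_independent_of_hodgeModel_holds`
(Serre's uniqueness of the analytification, functoriality of `(p,q)`-types, rigidity of natural de
Rham comparisons) — so they have the same dimension.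
[cite: SerreGAGA1956, §2 (unicité de X^h)] [cite: VoisinHodgeI2002, Prop. 6.11 and §7.3.2] -/
theorem _root_.Literature.AlgebraicGeometry.HodgeTheory.HodgeModel.finrank_hodgePQ_eq_of_hodgeModel
    (hY : IsSmoothProjective n Y) (A A' : HodgeModel n Y) (k p q : ℕ) :
    Module.finrank ℂ ↥(A.hodgePQ k p q) = Module.finrank ℂ ↥(A'.hodgePQ k p q) := by
  -- the common subspace of `Hᵏ(Y(ℂ); ℂ)`
  have hT : (A.hodgePQ k p q).comap (A.pullback k).hom =
      (A'.hodgePQ k p q).comap (A'.pullback k).hom := by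
    ext c
    simp only [Submodule.mem_comap]
    exact hodgePQ_independent_of_hodgeModel_holds.mem_hodgePQ_iff hY A A'
  -- its dimension is that of `H^{p,q}` of either model (the pull-backs are bijective)
  have key : ∀ A₀ : HodgeModel n Y,
      Module.finrank ℂ ↥((A₀.hodgePQ k p q).comap (A₀.pullback k).hom) =
        Module.finrank ℂ ↥(A₀.hodgePQ k p q) := by
    intro A₀
    have hmap : ((A₀.hodgePQ k p q).comap (A₀.pullback k).hom).map (A₀.pullback k).hom =
        A₀.hodgePQ k p q :=
      Submodule.map_comap_eq_of_surjective (A₀.pullback_surjective k) _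
    exact ((Submodule.equivMapOfInjective (A₀.pullback k).hom (A₀.pullback_injective k)
      ((A₀.hodgePQ k p q).comap (A₀.pullback k).hom)).trans (LinearEquiv.ofEq _ _ hmap)).finrank_eq
  rw [← key A, ← key A', hT]

end Models

/-! ### Nets over `ℂ`: Ehresmann over the smooth base, connectedness of `U(ℂ)` -/

namespace FiberNet

variable {r m : ℕ} {X : SchemeOver ℂ} (N : FiberNet r m X)

/-- **Ehresmann for nets, on the carriers `X̃(ℂ) → ℙᵐ(ℂ)`** (Voisin I Thm. 9.3 for the smooth
projective family `π⁻¹(U) → U`): every `t ∈ ℙᵐ(ℂ)` lying in the smooth base has an open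
neighbourhood `V ⊆ U(ℂ)` with `V × F ≃ₜ π(ℂ)⁻¹(V)` over `V`. The tree's PROVED
`exists_trivialisation_of_smoothOfRelativeDimension_morphismRestrict` (Bröcker–Jänich (8.12) on the
real manifolds of complex points) fed with the data of the net: `π` proper, `X̃` and `ℙᵐ` smooth and
separated with second countable complex points, `π|_U` smooth of relative dimension `r`.
[cite: VoisinHodgeI2002, §9.1.1 Thm. 9.3] [cite: BrockerJanichIDT1982, (8.12)] -/
theorem exists_trivialisation_smoothBase (t : ComplexPoints (projectiveSpace m ℂ))
    (ht : t.pt ∈ N.smoothBase) :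
    ∃ V : Set (ComplexPoints (projectiveSpace m ℂ)), IsOpen V ∧ t ∈ V ∧
      V ⊆ {s | s.pt ∈ N.smoothBase} ∧
      ∃ (F : Type) (_ : TopologicalSpace F)
        (φ : ↥V × F ≃ₜ ↥((AlgPoints.map N.proj : ComplexPoints N.total → _) ⁻¹' V)),
        ∀ x, AlgPoints.map N.proj (φ x : ComplexPoints N.total) = (x.1 : ComplexPoints _) := by
  haveI : SmoothOfRelativeDimension m (projectiveSpace m ℂ).hom :=
    (isSmoothProjective_projectiveSpace_holds ℂ m).smoothOfRelativeDimension
  haveI : IsProper (projectiveSpace m ℂ).hom := isProper_projectiveSpace m ℂ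
  haveI : IsSeparated (projectiveSpace m ℂ).hom := inferInstance
  haveI : Smooth (projectiveSpace m ℂ).hom := SmoothOfRelativeDimension.smooth m _
  haveI : LocallyOfFiniteType (projectiveSpace m ℂ).hom := inferInstance
  haveI : SecondCountableTopology (ComplexPoints (projectiveSpace m ℂ)) :=
    haveI : CompactSpace (projectiveSpace m ℂ).left :=
      QuasiCompact.compactSpace_of_compactSpace (projectiveSpace m ℂ).hom
    ComplexPoints.secondCountableTopology_of_compactSpace_holds _
  haveI : IsProper N.total.hom := N.isProper_total_hom
  haveI : IsSeparated N.total.hom := inferInstance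
  haveI : IsProper N.proj.left := N.isProper_proj
  haveI : LocallyOfFiniteType N.total.hom := inferInstance
  haveI : SecondCountableTopology (ComplexPoints N.total) :=
    haveI : CompactSpace N.total.left := QuasiCompact.compactSpace_of_compactSpace N.total.hom
    ComplexPoints.secondCountableTopology_of_compactSpace_holds _
  haveI : SmoothOfRelativeDimension r (N.proj.left ∣_ N.smoothBase) :=
    N.smoothOfRelativeDimension_restrict _ N.smooth_proj_restrict
  exact exists_trivialisation_of_smoothOfRelativeDimension_morphismRestrict N.proj N.smoothBase r m t ht

/-- **`U(ℂ)` is connected** (when non-empty), as a subset of `ℙᵐ(ℂ)`: the smooth base `U` is a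
non-empty open subset of the irreducible `ℙᵐ_ℂ`, and the complex points of an irreducible variety
lying in an open form a connected set in the analytic topology (SGA1 XII Prop. 2.4; the tree's
`ComplexPoints.isConnected_setOf_pt_mem_inter_of_isIrreducible` with `C = ℙᵐ`, `W = U`). (The
intrinsic form, `U(ℂ)` preconnected as the complex points of the scheme `U`, is
`preconnectedSpace_complexPoints_smoothBaseOver` of `Motives/FiberNetExistenceProofs`.)
[cite: SGA1, Exp. XII Prop. 2.4] -/
theorem isConnected_setOf_pt_mem_smoothBase
    (hU : (N.smoothBase : Set (projectiveSpace m ℂ).left).Nonempty) :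
    IsConnected {s : ComplexPoints (projectiveSpace m ℂ) | s.pt ∈ N.smoothBase} := by
  haveI : SmoothOfRelativeDimension m (projectiveSpace m ℂ).hom :=
    (isSmoothProjective_projectiveSpace_holds ℂ m).smoothOfRelativeDimension
  haveI : Smooth (projectiveSpace m ℂ).hom := SmoothOfRelativeDimension.smooth m _
  haveI : LocallyOfFiniteType (projectiveSpace m ℂ).hom := inferInstance
  haveI : IsIntegral (projectiveSpace m ℂ).left :=
    IsSmoothProjective.isIntegral_holds (isSmoothProjective_projectiveSpace_holds ℂ m)
  have h := ComplexPoints.isConnected_setOf_pt_mem_inter_of_isIrreducible (projectiveSpace m ℂ)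
    isClosed_univ (IrreducibleSpace.isIrreducible_univ _) N.smoothBase
    (by simpa only [Set.univ_inter] using hU)
  simpa only [Set.mem_univ, true_and, SetLike.mem_coe] using h

/-- **All smooth fibres of a net over `ℂ` are homeomorphic**: for `ℂ`-points `b`, `b'` of `ℙᵐ`
in the smooth base, `X_b(ℂ) ≃ₜ X_{b'}(ℂ)`. Ehresmann (`exists_trivialisation_smoothBase`) makes the
fibres of `π(ℂ)` locally constant up to homeomorphism over the connected `U(ℂ)`
(`isConnected_setOf_pt_mem_smoothBase`, `nonempty_homeomorph_fibre_of_isPreconnected`), and the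
complex points of the scheme-theoretic fibre ARE the topological fibre (`fiberHomeomorph`, `π`
proper). Voisin I §9.1.1: the fibres of a family of compact complex manifolds over a connected base
are all diffeomorphic (here: homeomorphic, which is what the tree's Ehresmann records).
[cite: VoisinHodgeI2002, §9.1.1 Def. 9.2 and Thm. 9.3] -/
theorem nonempty_homeomorph_complexPoints_fiber {b b' : ComplexPoints (projectiveSpace m ℂ)}
    (hb : b.pt ∈ N.smoothBase) (hb' : b'.pt ∈ N.smoothBase) :
    Nonempty (ComplexPoints (N.fiber b) ≃ₜ ComplexPoints (N.fiber b')) := by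
  haveI : IsProper N.total.hom := N.isProper_total_hom
  haveI : IsSeparated N.total.hom := inferInstance
  haveI : IsProper N.proj.left := N.isProper_proj
  have hconn := N.isConnected_setOf_pt_mem_smoothBase ⟨b.pt, hb⟩
  have htriv : ∀ t ∈ {s : ComplexPoints (projectiveSpace m ℂ) | s.pt ∈ N.smoothBase},
      ∃ V : Set (ComplexPoints (projectiveSpace m ℂ)), IsOpen V ∧ t ∈ V ∧
        ∃ (F : Type) (_ : TopologicalSpace F)
          (φ : ↥V × F ≃ₜ ↥((AlgPoints.map N.proj : ComplexPoints N.total → _) ⁻¹' V)),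
          ∀ x, AlgPoints.map N.proj (φ x : ComplexPoints N.total) = (x.1 : ComplexPoints _) := by
    intro t ht
    obtain ⟨V, hVo, htV, -, F, _, φ, hφ⟩ := N.exists_trivialisation_smoothBase t ht
    exact ⟨V, hVo, htV, F, inferInstance, φ, hφ⟩
  obtain ⟨e⟩ := nonempty_homeomorph_fibre_of_isPreconnected
    (AlgPoints.map N.proj : ComplexPoints N.total → ComplexPoints (projectiveSpace m ℂ))
    hconn.isPreconnected htriv hb hb'
  exact ⟨(fiberHomeomorph N.proj b).trans (e.trans (fiberHomeomorph N.proj b').symm)⟩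

/-- **The Betti numbers of the smooth fibres of a net over `ℂ` are all equal**: `b_k(X_b) = b_k(X_{b'})`
for `b, b' ∈ U(ℂ)` (homeomorphic spaces have isomorphic singular cohomology,
`singularCohomology.mapIso`); the global form of "as `X_b` is diffeomorphic to `X`, we have
`dim Hᵏ(X_b, ℂ) = dim Hᵏ(X, ℂ) = b_k`" in Voisin's proof of Prop. 9.20.
[cite: VoisinHodgeI2002, §9.3.2 Prop. 9.20 (proof)] -/
theorem finrank_complexBetti_fiber_eq {b b' : ComplexPoints (projectiveSpace m ℂ)}
    (hb : b.pt ∈ N.smoothBase) (hb' : b'.pt ∈ N.smoothBase) (k : ℕ) :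
    Module.finrank ℂ (complexBetti (N.fiber b) k) = Module.finrank ℂ (complexBetti (N.fiber b') k) := by
  obtain ⟨e⟩ := N.nonempty_homeomorph_complexPoints_fiber hb hb'
  exact ((singularCohomology.mapIso (R := ℂ) (M := ℂ) e k).toLinearEquiv.finrank_eq).symm

/-! ### The Hodge numbers of the smooth fibres do not depend on the Hodge models -/

/-- If the smooth fibres of `N` have `h^{p,q} = h` (a Hodge model with `dim H^{p,q} = h` over every
`ℂ`-point of the smooth base), then EVERY Hodge model of every smooth fibre has `dim H^{p,q} = h`
(`HodgeModel.finrank_hodgePQ_eq_of_hodgeModel`; the fibres are smooth projective,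
`isSmoothProjective_fiber_of_mem_smoothBase`). [cite: VoisinHodgeI2002, Prop. 6.11 and §7.3.2] -/
theorem HasFibreHodgeNumber.finrank_eq {N : FiberNet r m X} {k p q h : ℕ}
    (hN : N.HasFibreHodgeNumber k p q h) {b : ComplexPoints (projectiveSpace m ℂ)}
    (hb : b.pt ∈ N.smoothBase) (A : HodgeModel r (N.fiber b)) :
    Module.finrank ℂ ↥(A.hodgePQ k p q) = h := by
  obtain ⟨A₀, hA₀⟩ := hN b hb
  rw [← hA₀]
  exact HodgeModel.finrank_hodgePQ_eq_of_hodgeModel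
    (N.isSmoothProjective_fiber_of_mem_smoothBase b hb) A A₀ k p q

/-- **The `h` of `HasFibreHodgeNumber` is unique** as soon as the smooth base is non-empty (over
`ℂ` it always is, `smoothBase_nonempty_of_charZero`): a non-empty open `U` has a `ℂ`-point
(`ComplexPoints.exists_pt_mem`, Nullstellensatz), over which the two values are the dimension of
`H^{p,q}` of two Hodge models of the same smooth projective fibre
(`HodgeModel.finrank_hodgePQ_eq_of_hodgeModel`). This is the uniqueness left open in the module
docstring of `Motives/SurfaceNetGeometricGenus`. [cite: VoisinHodgeI2002, Prop. 6.11 and §7.3.2] -/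
theorem HasFibreHodgeNumber.unique {N : FiberNet r m X} {k p q h h' : ℕ}
    (hN : N.HasFibreHodgeNumber k p q h) (hN' : N.HasFibreHodgeNumber k p q h')
    (hU : (N.smoothBase : Set (projectiveSpace m ℂ).left).Nonempty) : h = h' := by
  haveI : SmoothOfRelativeDimension m (projectiveSpace m ℂ).hom :=
    (isSmoothProjective_projectiveSpace_holds ℂ m).smoothOfRelativeDimension
  haveI : Smooth (projectiveSpace m ℂ).hom := SmoothOfRelativeDimension.smooth m _
  haveI : LocallyOfFiniteType (projectiveSpace m ℂ).hom := inferInstance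
  obtain ⟨b, hb⟩ := ComplexPoints.exists_pt_mem (X := projectiveSpace m ℂ) hU
    N.smoothBase.isOpen.isLocallyClosed
  obtain ⟨A, hA⟩ := hN b hb
  rw [← hA]
  exact hN'.finrank_eq hb A

/-- Over `ℂ` the `h` of `HasFibreHodgeNumber` is unique, unconditionally (the smooth base of a net
over a field of characteristic `0` is non-empty by generic smoothness,
`smoothBase_nonempty_of_charZero`). [cite: Hartshorne1977, III Cor. 10.7] -/
theorem HasFibreHodgeNumber.unique' {N : FiberNet r m X} {k p q h h' : ℕ}
    (hN : N.HasFibreHodgeNumber k p q h) (hN' : N.HasFibreHodgeNumber k p q h') : h = h' :=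
  hN.unique hN' N.smoothBase_nonempty_of_charZero

end FiberNet

end Literature.AlgebraicGeometry.Motives

end
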